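import Summits.Parity.BatemanHorn.Theorems.IsogenyRedeiOmegaToMobiusAPCounting
import Summits.Parity.BatemanHorn.Theorems.IsogenyRedeiOmegaToMobiusAPSieve
import Literature.NumberTheory.Sieve.ParityBarrier

/-!
# Lemmas for the junction `LiouvilleAP → QuadraticOmegaParity` (crux stmt-Parity-11585)

Pointwise inputs of the valuation-truncated squarefree sieve which converts Liouville parity
`λ(f(n)) = (−1)^{Ω(f(n))}` of the values of an integer quadratic along arithmetic progressions into
ω-parity `(−1)^{ω(f(n))}` (the crux `QuadraticOmegaParity` of route `IsogenyRedei`).  With a level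
`L` and a valuation cut-off `K`:

* `neg_one_pow_cardDistinctFactors_eq` (registered alias `liouvilleAPToOmega_parityIdentity`):
  for `m ≠ 0` free of squares of primes `> L`, `(−1)^{ω(m)} = λ(m)·(−1)^{Σ_{p ≤ L, p ∣ m} (v_p+1)}`;
* `padicValInt_eq_of_pow_dvd_sub`, `sum_padicValInt_congr`: that small-prime sign only depends on
  `z` modulo `∏_{p ≤ L} p^K` as long as no `p ≤ L` has `p^K ∣ z`;
* `card_filter_Icc_dvd_eval_le`: `#{n ∈ [1, x] : d ∣ f(n)} ≤ ρ_f(d) · (x/d + 1)`;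
* `abs_pointwise_error_le`: the pointwise comparison of `(−1)^{ω(f(n))}` with
  `θ(n mod M) · 1[class of n good] · λ(f(n))`, `M = q · (L!)^K`.

Everything here is elementary (Mathlib's `Nat.factorization`, `padicValInt`,
`ArithmeticFunction.liouville`; `|λ| ≤ 1` is `Literature.NumberTheory.Sieve.abs_liouville_le_one`);
the counting inputs (`card_filter_Icc_modEq_le`, `π(N) = o(N)`, `isLittleO_of_forall_approx`) come
from `IsogenyRedeiOmegaToMobiusAPCounting`.
-/

open Filter Finset Asymptotics Polynomial

namespace Summit.Parity.BatemanHorn.Theorems.LiouvilleAPToOmega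

open Summit.Parity.BatemanHorn.Theorems.OmegaToMobiusAP

/-! ### The parity identity `(−1)^ω = λ · (small-prime sign)` -/

/-- For `m ≠ 0` with no prime `p > L` such that `p² ∣ m`:
`(−1)^{ω(m)} = λ(m) · (−1)^{Σ_{p ≤ L prime, p ∣ m} (v_p(m) + 1)}`. [folklore] -/
theorem neg_one_pow_cardDistinctFactors_eq {m L : ℕ} (hm : m ≠ 0)
    (h : ∀ p : ℕ, p.Prime → L < p → ¬ p ^ 2 ∣ m) :
    (-1 : ℝ) ^ ArithmeticFunction.cardDistinctFactors m =
      (ArithmeticFunction.liouville m : ℝ) *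
        (-1 : ℝ) ^ ∑ p ∈ (Nat.primesLE L).filter (· ∣ m), (m.factorization p + 1) := by
  classical
  have hω : ArithmeticFunction.cardDistinctFactors m = ∑ p ∈ m.primeFactors, 1 := by
    rw [ArithmeticFunction.cardDistinctFactors_apply, ← List.card_toFinset, Nat.toFinset_factors,
      Finset.card_eq_sum_ones]
  have hΩ : ArithmeticFunction.cardFactors m = ∑ p ∈ m.primeFactors, m.factorization p := by
    rw [ArithmeticFunction.cardFactors_eq_sum_factorization]
    rfl
  have hl : (ArithmeticFunction.liouville m : ℝ) = (-1 : ℝ) ^ ArithmeticFunction.cardFactors m := by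
    rw [ArithmeticFunction.liouville_apply hm]
    push_cast
    rfl
  set S := m.primeFactors.filter (· ≤ L) with hS
  set T := m.primeFactors.filter (fun p => ¬ p ≤ L) with hT
  have hST : ∑ p ∈ m.primeFactors, (m.factorization p + 1)
      = ∑ p ∈ S, (m.factorization p + 1) + ∑ p ∈ T, (m.factorization p + 1) :=
    (Finset.sum_filter_add_sum_filter_not _ _ _).symm
  have hT2 : ∑ p ∈ T, (m.factorization p + 1) = 2 * T.card := by
    rw [Finset.card_eq_sum_ones, Finset.mul_sum]
    refine Finset.sum_congr rfl (fun p hp => ?_)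
    obtain ⟨hp1, hp2⟩ := Finset.mem_filter.mp hp
    have hpp : p.Prime := (Nat.mem_primeFactors.mp hp1).1
    have hpm : p ∣ m := (Nat.mem_primeFactors.mp hp1).2.1
    have h1 : 1 ≤ m.factorization p := hpp.factorization_pos_of_dvd hm hpm
    have h2 : ¬ 2 ≤ m.factorization p := fun h2 =>
      h p hpp (not_le.mp hp2) ((hpp.pow_dvd_iff_le_factorization hm).mpr h2)
    omega
  have hSeq : S = (Nat.primesLE L).filter (· ∣ m) := by
    ext p
    simp only [hS, Finset.mem_filter, Nat.mem_primeFactors, Nat.mem_primesLE]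
    constructor
    · rintro ⟨⟨hp, hpm, -⟩, hpL⟩
      exact ⟨⟨hpL, hp⟩, hpm⟩
    · rintro ⟨⟨hpL, hp⟩, hpm⟩
      exact ⟨⟨hp, hpm, hm⟩, hpL⟩
  have hall : ∑ p ∈ m.primeFactors, (m.factorization p + 1)
      = ArithmeticFunction.cardFactors m + ArithmeticFunction.cardDistinctFactors m := by
    rw [Finset.sum_add_distrib, hΩ, hω]
  have heven : Even (ArithmeticFunction.cardFactors m + ArithmeticFunction.cardDistinctFactors m
      + ∑ p ∈ S, (m.factorization p + 1)) := by
    rw [← hall, hST, hT2]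
    exact ⟨∑ p ∈ S, (m.factorization p + 1) + T.card, by ring⟩
  rw [hl, ← hSeq, ← pow_add]
  have key : ∀ a b : ℕ, Even (a + b) → (-1 : ℝ) ^ a = (-1) ^ b := by
    intro a b hab
    have h1 : (-1 : ℝ) ^ a * (-1) ^ b = (-1) ^ b * (-1) ^ b := by
      rw [← pow_add, ← pow_add, hab.neg_one_pow, Even.neg_one_pow ⟨b, rfl⟩]
    exact mul_right_cancel₀ (pow_ne_zero _ (by norm_num)) h1
  refine key _ _ ?_
  have e : ArithmeticFunction.cardDistinctFactors m
      + (ArithmeticFunction.cardFactors m + ∑ p ∈ S, (m.factorization p + 1))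
      = ArithmeticFunction.cardFactors m + ArithmeticFunction.cardDistinctFactors m
      + ∑ p ∈ S, (m.factorization p + 1) := by ring
  rw [e]
  exact heven

/-- The exponent of the small-prime sign of `m : ℕ` in terms of `padicValInt` of `(m : ℤ)`.
[folklore] -/
theorem sum_factorization_eq_sum_padicValInt (m L : ℕ) :
    ∑ p ∈ (Nat.primesLE L).filter (· ∣ m), (m.factorization p + 1)
      = ∑ p ∈ (Nat.primesLE L).filter (fun p : ℕ => (p : ℤ) ∣ (m : ℤ)),
          (padicValInt p (m : ℤ) + 1) := by
  have h1 : (Nat.primesLE L).filter (· ∣ m)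
      = (Nat.primesLE L).filter (fun p : ℕ => (p : ℤ) ∣ (m : ℤ)) :=
    Finset.filter_congr (fun p _ => Int.natCast_dvd_natCast.symm)
  rw [h1]
  refine Finset.sum_congr rfl (fun p hp => ?_)
  rw [padicValInt.of_nat,
    Nat.factorization_def m (Nat.prime_of_mem_primesLE (Finset.mem_filter.mp hp).1)]

/-! ### The small-prime sign is periodic on good classes -/

/-- If `p^K ∣ a − b` and `p^K ∤ b` then `v_p(a) = v_p(b)`. [folklore] -/
theorem padicValInt_eq_of_pow_dvd_sub {p K : ℕ} (hp : p.Prime) {a b : ℤ}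
    (hab : (p : ℤ) ^ K ∣ a - b) (hb : ¬ (p : ℤ) ^ K ∣ b) :
    padicValInt p a = padicValInt p b := by
  have hp1 : p ≠ 1 := hp.ne_one
  have hb0 : b ≠ 0 := fun h0 => hb (h0 ▸ dvd_zero _)
  have ha0 : a ≠ 0 := by
    rintro rfl
    apply hb
    rw [zero_sub, dvd_neg] at hab
    exact hab
  set v := padicValInt p b with hv
  have hvK : v < K := by
    by_contra hle
    push Not at hle
    exact hb ((pow_dvd_pow (p : ℤ) hle).trans (padicValInt_dvd b))
  apply le_antisymm
  · by_contra hlt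
    push Not at hlt
    have h1 : (p : ℤ) ^ (v + 1) ∣ a := (padicValInt_dvd_iff_of_ne_one hp1 _ _).mpr (Or.inr hlt)
    have h2 : (p : ℤ) ^ (v + 1) ∣ a - b := (pow_dvd_pow (p : ℤ) hvK).trans hab
    have h3 : (p : ℤ) ^ (v + 1) ∣ b := by
      have := dvd_sub h1 h2
      rwa [sub_sub_cancel] at this
    rcases (padicValInt_dvd_iff_of_ne_one hp1 _ _).mp h3 with h4 | h4
    · exact hb0 h4
    · omega
  · have h1 : (p : ℤ) ^ v ∣ b := padicValInt_dvd b
    have h2 : (p : ℤ) ^ v ∣ a - b := (pow_dvd_pow (p : ℤ) hvK.le).trans hab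
    have h3 : (p : ℤ) ^ v ∣ a := by
      have := dvd_add h2 h1
      rwa [sub_add_cancel] at this
    rcases (padicValInt_dvd_iff_of_ne_one hp1 _ _).mp h3 with h4 | h4
    · exact absurd h4 ha0
    · exact h4

/-- The exponent of the small-prime sign agrees at `a` and `b` when `p^K ∣ a − b` and `p^K ∤ b`
for every prime `p ≤ L`. [folklore] -/
theorem sum_padicValInt_congr {L K : ℕ} {a b : ℤ}
    (hab : ∀ p ∈ Nat.primesLE L, (p : ℤ) ^ K ∣ a - b)
    (hb : ∀ p ∈ Nat.primesLE L, ¬ (p : ℤ) ^ K ∣ b) :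
    ∑ p ∈ (Nat.primesLE L).filter (fun p : ℕ => (p : ℤ) ∣ a), (padicValInt p a + 1)
      = ∑ p ∈ (Nat.primesLE L).filter (fun p : ℕ => (p : ℤ) ∣ b), (padicValInt p b + 1) := by
  have hK : ∀ p ∈ Nat.primesLE L, K ≠ 0 := by
    intro p hp hK0
    apply hb p hp
    rw [hK0, pow_zero]
    exact one_dvd _
  have hdvd : ∀ p ∈ Nat.primesLE L, ((p : ℤ) ∣ a ↔ (p : ℤ) ∣ b) := by
    intro p hp
    exact dvd_iff_dvd_of_dvd_sub ((dvd_pow_self (p : ℤ) (hK p hp)).trans (hab p hp))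
  rw [Finset.filter_congr (fun p hp => hdvd p hp)]
  refine Finset.sum_congr rfl (fun p hp => ?_)
  rw [Finset.mem_filter] at hp
  rw [padicValInt_eq_of_pow_dvd_sub (Nat.prime_of_mem_primesLE hp.1) (hab p hp.1) (hb p hp.1)]

/-- `p^j ∣ f(n) − f(c)` whenever `p^j ∣ M` and `n ≡ c (mod M)`. [folklore] -/
theorem pow_dvd_eval_sub_eval (f : ℤ[X]) {p j M n c : ℕ} (hpM : p ^ j ∣ M)
    (hnc : n ≡ c [MOD M]) :
    (p : ℤ) ^ j ∣ f.eval (n : ℤ) - f.eval (c : ℤ) := by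
  have h1 : (M : ℤ) ∣ (n : ℤ) - (c : ℤ) := Nat.modEq_iff_dvd.mp hnc.symm
  have h2 : (p : ℤ) ^ j ∣ (M : ℤ) := by exact_mod_cast hpM
  exact (h2.trans h1).trans (Polynomial.sub_dvd_eval_sub _ _ _)

/-- For a prime `p ≤ L`, `p^K` divides the sieve modulus `q · (L!)^K`. [folklore] -/
theorem pow_dvd_modulus {p L : ℕ} (hp : p.Prime) (hpL : p ≤ L) (q K : ℕ) :
    p ^ K ∣ q * Nat.factorial L ^ K :=
  Dvd.dvd.mul_left (pow_dvd_pow_of_dvd (Nat.dvd_factorial hp.pos hpL) K) q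

/-! ### Counting -/

/-- **Local count at a general modulus.** `#{n ∈ [1, x] : d ∣ f(n)} ≤ ρ_f(d) · (x / d + 1)` for
`d ≥ 1`, where `ρ_f(d) = #{ν < d : d ∣ f(ν)}`. [folklore] -/
theorem card_filter_Icc_dvd_eval_le (f : ℤ[X]) {d : ℕ} (hd : 0 < d) (x : ℕ) :
    ((Finset.Icc 1 x).filter (fun n : ℕ => (d : ℤ) ∣ f.eval (n : ℤ))).card ≤
      ((Finset.range d).filter (fun ν : ℕ => (d : ℤ) ∣ f.eval (ν : ℤ))).card * (x / d + 1) := by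
  classical
  set S := (Finset.Icc 1 x).filter (fun n : ℕ => (d : ℤ) ∣ f.eval (n : ℤ)) with hS
  set T := (Finset.range d).filter (fun ν : ℕ => (d : ℤ) ∣ f.eval (ν : ℤ)) with hT
  have hmaps : (S : Set ℕ).MapsTo (fun n => n % d) T := by
    intro n hn
    rw [Finset.mem_coe, Finset.mem_filter] at hn
    rw [Finset.mem_coe, Finset.mem_filter, Finset.mem_range]
    refine ⟨Nat.mod_lt n hd, ?_⟩
    have h1 : (d : ℤ) ^ 1 ∣ f.eval (n : ℤ) - f.eval ((n % d : ℕ) : ℤ) :=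
      pow_dvd_eval_sub_eval f (by rw [pow_one]) (Nat.mod_modEq n d).symm
    rw [pow_one] at h1
    exact (dvd_sub_right hn.2).mp h1
  rw [Finset.card_eq_sum_card_fiberwise hmaps]
  calc ∑ b ∈ T, (S.filter (fun a => a % d = b)).card
      ≤ ∑ b ∈ T, (x / d + 1) := by
        refine Finset.sum_le_sum (fun b hb => ?_)
        have hbd : b < d := Finset.mem_range.mp (Finset.mem_filter.mp hb).1
        calc (S.filter (fun a => a % d = b)).card
            ≤ ((Finset.Icc 1 x).filter (fun n : ℕ => (n : ℤ) ≡ (b : ℤ) [ZMOD d])).card := by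
              refine Finset.card_le_card (fun n hn => ?_)
              rw [Finset.mem_filter] at hn ⊢
              refine ⟨(Finset.mem_filter.mp hn.1).1, ?_⟩
              rw [Int.natCast_modEq_iff]
              unfold Nat.ModEq
              rw [hn.2, Nat.mod_eq_of_lt hbd]
          _ ≤ x / d + 1 := card_filter_Icc_modEq_le x d b
    _ = T.card * (x / d + 1) := by rw [Finset.sum_const, smul_eq_mul]

/-! ### The pointwise error -/

/-- A prime whose square divides `f(n)`, `1 ≤ n ≤ x`, `0 < f(n) ≤ B x²`, is at most `B x`.
[folklore] -/
theorem prime_le_of_sq_dvd (f : ℤ[X]) (Bh : ℕ) (hBh1 : 1 ≤ Bh)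
    (hBh : ∀ n x : ℕ, 1 ≤ n → n ≤ x → f.eval (n : ℤ) ≤ (Bh : ℤ) * (x : ℤ) ^ 2)
    {x n p : ℕ} (hn : n ∈ Finset.Icc 1 x) (hm0 : (f.eval (n : ℤ)).toNat ≠ 0)
    (hpm : p ^ 2 ∣ (f.eval (n : ℤ)).toNat) : p ≤ Bh * x := by
  set m := (f.eval (n : ℤ)).toNat with hm
  rw [Finset.mem_Icc] at hn
  have hpos : 0 < f.eval (n : ℤ) := by
    by_contra hle
    push Not at hle
    exact hm0 (Int.toNat_eq_zero.mpr hle)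
  have hmcast : ((m : ℕ) : ℤ) = f.eval (n : ℤ) := Int.toNat_of_nonneg hpos.le
  have h1 : p ^ 2 ≤ m := Nat.le_of_dvd (Nat.pos_of_ne_zero hm0) hpm
  have h2 : m ≤ Bh * x ^ 2 := by
    have h := hBh n x hn.1 hn.2
    rw [← hmcast] at h
    exact_mod_cast h
  have h3 : Bh * x ^ 2 ≤ (Bh * x) ^ 2 := by
    rw [mul_pow]
    exact Nat.mul_le_mul_right _ (by nlinarith)
  exact (Nat.pow_le_pow_iff_left two_ne_zero).mp (h1.trans (h2.trans h3))

/-- **Exact case of the pointwise comparison.** For `f(n) > 0`, `n ≡ c (mod M)` with `p^K ∣ M`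
and `p^K ∤ f(c)` for all primes `p ≤ L`, and no prime `p > L` with `p² ∣ f(n)`:
`(−1)^{ω(f(n))} = (−1)^{Σ_{p ≤ L, p ∣ f(c)} (v_p(f(c)) + 1)} · λ(f(n))`. [folklore] -/
theorem neg_one_pow_cardDistinctFactors_eval_eq (f : ℤ[X]) {L K M n c : ℕ}
    (hpos : 0 < f.eval (n : ℤ)) (hM : ∀ p ∈ Nat.primesLE L, p ^ K ∣ M) (hnc : n ≡ c [MOD M])
    (hP : ∀ p ∈ Nat.primesLE L, ¬ ((p : ℤ) ^ K ∣ f.eval (c : ℤ)))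
    (hlarge : ∀ p : ℕ, p.Prime → L < p → ¬ p ^ 2 ∣ (f.eval (n : ℤ)).toNat) :
    (-1 : ℝ) ^ ArithmeticFunction.cardDistinctFactors ((f.eval (n : ℤ)).toNat)
      = (-1 : ℝ) ^ (∑ p ∈ (Nat.primesLE L).filter (fun p : ℕ => (p : ℤ) ∣ f.eval (c : ℤ)),
            (padicValInt p (f.eval (c : ℤ)) + 1))
        * (ArithmeticFunction.liouville ((f.eval (n : ℤ)).toNat) : ℝ) := by
  set m := (f.eval (n : ℤ)).toNat with hm
  have hmcast : ((m : ℕ) : ℤ) = f.eval (n : ℤ) := Int.toNat_of_nonneg hpos.le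
  have hm0 : m ≠ 0 := by
    intro h0
    rw [h0] at hmcast
    simp at hmcast
    linarith
  rw [neg_one_pow_cardDistinctFactors_eq hm0 hlarge, sum_factorization_eq_sum_padicValInt m L,
    hmcast, mul_comm]
  congr 2
  exact sum_padicValInt_congr (fun p hp => pow_dvd_eval_sub_eval f (hM p hp) hnc) hP

/-- **Pointwise error.** With `g n = f(n).toNat`, `s n = (−1)^{ω(g n)}`, `M = q (L!)^K`,
`θ(c) = (−1)^{Σ_{p ≤ L, p ∣ f(c)} (v_p(f(c)) + 1)}` and `χ n = 1[∀ p ≤ L prime, p^K ∤ f(n mod M)]`: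
`|s(n) − θ(n mod M) χ(n) λ(g n)| ≤ 2·1[n < N₀] + Σ_{p ≤ L prime} 1[p^K ∣ f(n)]
  + 2 Σ_{p prime, L < p ≤ Bx} 1[p² ∣ f(n)]` for `1 ≤ n ≤ x`. [folklore] -/
theorem abs_pointwise_error_le (f : ℤ[X]) (N₀ : ℕ) (hN₀ : ∀ n : ℕ, N₀ ≤ n → 0 < f.eval (n : ℤ))
    (Bh : ℕ) (hBh1 : 1 ≤ Bh)
    (hBh : ∀ n x : ℕ, 1 ≤ n → n ≤ x → f.eval (n : ℤ) ≤ (Bh : ℤ) * (x : ℤ) ^ 2)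
    (q L K : ℕ) {x n : ℕ} (hn : n ∈ Finset.Icc 1 x) :
    |(-1 : ℝ) ^ ArithmeticFunction.cardDistinctFactors ((f.eval (n : ℤ)).toNat)
        - (-1 : ℝ) ^ (∑ p ∈ (Nat.primesLE L).filter
              (fun p : ℕ => (p : ℤ) ∣ f.eval (((n % (q * Nat.factorial L ^ K) : ℕ)) : ℤ)),
              (padicValInt p (f.eval (((n % (q * Nat.factorial L ^ K) : ℕ)) : ℤ)) + 1))
          * (if ∀ p ∈ Nat.primesLE L,
                ¬ ((p : ℤ) ^ K ∣ f.eval (((n % (q * Nat.factorial L ^ K) : ℕ)) : ℤ))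
              then (1 : ℝ) else 0)
          * (ArithmeticFunction.liouville ((f.eval (n : ℤ)).toNat) : ℝ)|
      ≤ 2 * (if n < N₀ then (1 : ℝ) else 0)
        + (∑ p ∈ Nat.primesLE L, if (p : ℤ) ^ K ∣ f.eval (n : ℤ) then (1 : ℝ) else 0)
        + 2 * ∑ p ∈ (Nat.primesLE (Bh * x)).filter (fun p => L < p),
            (if (p : ℤ) ^ 2 ∣ f.eval (n : ℤ) then (1 : ℝ) else 0) := by
  set M := q * Nat.factorial L ^ K with hMdef
  set m := (f.eval (n : ℤ)).toNat with hm
  set θ : ℝ := (-1 : ℝ) ^ (∑ p ∈ (Nat.primesLE L).filter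
      (fun p : ℕ => (p : ℤ) ∣ f.eval (((n % M : ℕ)) : ℤ)),
      (padicValInt p (f.eval (((n % M : ℕ)) : ℤ)) + 1)) with hθ
  have hθ1 : |θ| = 1 := by
    rw [hθ, abs_pow, abs_neg, abs_one, one_pow]
  have hsmall_nonneg : 0 ≤ ∑ p ∈ Nat.primesLE L,
      (if (p : ℤ) ^ K ∣ f.eval (n : ℤ) then (1 : ℝ) else 0) :=
    Finset.sum_nonneg (fun p _ => by split_ifs <;> norm_num)
  have hlarge_nonneg : 0 ≤ ∑ p ∈ (Nat.primesLE (Bh * x)).filter (fun p => L < p),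
      (if (p : ℤ) ^ 2 ∣ f.eval (n : ℤ) then (1 : ℝ) else 0) :=
    Finset.sum_nonneg (fun p _ => by split_ifs <;> norm_num)
  have hper : ∀ p ∈ Nat.primesLE L, p ^ K ∣ M := fun p hp =>
    pow_dvd_modulus (Nat.prime_of_mem_primesLE hp) (Nat.le_of_mem_primesLE hp) q K
  have hnc : n ≡ n % M [MOD M] := (Nat.mod_modEq n M).symm
  -- the trivial bound `2`
  have htriv : |(-1 : ℝ) ^ ArithmeticFunction.cardDistinctFactors m
      - θ * (if ∀ p ∈ Nat.primesLE L, ¬ ((p : ℤ) ^ K ∣ f.eval (((n % M : ℕ)) : ℤ))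
              then (1 : ℝ) else 0)
          * (ArithmeticFunction.liouville m : ℝ)| ≤ 2 := by
    have h1 : |(-1 : ℝ) ^ ArithmeticFunction.cardDistinctFactors m| ≤ 1 := by
      rw [abs_pow, abs_neg, abs_one, one_pow]
    have h2 : |θ * (if ∀ p ∈ Nat.primesLE L, ¬ ((p : ℤ) ^ K ∣ f.eval (((n % M : ℕ)) : ℤ))
              then (1 : ℝ) else 0)
          * (ArithmeticFunction.liouville m : ℝ)| ≤ 1 := by
      rw [abs_mul, abs_mul, hθ1, one_mul]
      have h3 := Literature.NumberTheory.Sieve.abs_liouville_le_one m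
      split_ifs
      · rw [abs_one, one_mul]
        exact h3
      · rw [abs_zero, zero_mul]
        exact zero_le_one
    calc _ ≤ |(-1 : ℝ) ^ ArithmeticFunction.cardDistinctFactors m|
          + |θ * (if ∀ p ∈ Nat.primesLE L, ¬ ((p : ℤ) ^ K ∣ f.eval (((n % M : ℕ)) : ℤ))
              then (1 : ℝ) else 0)
            * (ArithmeticFunction.liouville m : ℝ)| := abs_sub _ _
      _ ≤ 1 + 1 := add_le_add h1 h2
      _ = 2 := by norm_num
  by_cases hnN : n < N₀
  · rw [if_pos hnN, mul_one]
    linarith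
  · push Not at hnN
    rw [if_neg (not_lt.mpr hnN), mul_zero, zero_add]
    have hpos : 0 < f.eval (n : ℤ) := hN₀ n hnN
    have hmcast : ((m : ℕ) : ℤ) = f.eval (n : ℤ) := Int.toNat_of_nonneg hpos.le
    have hm0 : m ≠ 0 := by
      intro h0
      rw [h0] at hmcast
      simp at hmcast
      linarith
    by_cases hP : ∀ p ∈ Nat.primesLE L, ¬ ((p : ℤ) ^ K ∣ f.eval (((n % M : ℕ)) : ℤ))
    · rw [if_pos hP, mul_one]
      by_cases hlg : ∃ p : ℕ, p.Prime ∧ L < p ∧ p ^ 2 ∣ m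
      · -- a large prime square: bound by the large-prime indicator sum
        obtain ⟨p, hpp, hLp, hpm⟩ := hlg
        have hpB : p ≤ Bh * x := prime_le_of_sq_dvd f Bh hBh1 hBh hn hm0 hpm
        have hpf : (p : ℤ) ^ 2 ∣ f.eval (n : ℤ) := by
          rw [← hmcast]
          exact_mod_cast hpm
        have hpmem : p ∈ (Nat.primesLE (Bh * x)).filter (fun p => L < p) := by
          rw [Finset.mem_filter, Nat.mem_primesLE]
          exact ⟨⟨hpB, hpp⟩, hLp⟩
        have hone : (1 : ℝ) ≤ ∑ p ∈ (Nat.primesLE (Bh * x)).filter (fun p => L < p),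
            (if (p : ℤ) ^ 2 ∣ f.eval (n : ℤ) then (1 : ℝ) else 0) := by
          calc (1 : ℝ) = (if (p : ℤ) ^ 2 ∣ f.eval (n : ℤ) then (1 : ℝ) else 0) := by
                rw [if_pos hpf]
            _ ≤ _ := Finset.single_le_sum (f := fun p : ℕ =>
                  (if (p : ℤ) ^ 2 ∣ f.eval (n : ℤ) then (1 : ℝ) else 0))
                (fun p _ => by split_ifs <;> norm_num) hpmem
        have h2 : |(-1 : ℝ) ^ ArithmeticFunction.cardDistinctFactors m
            - θ * (ArithmeticFunction.liouville m : ℝ)| ≤ 2 := by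
          have := htriv
          rwa [if_pos hP, mul_one] at this
        linarith
      · -- the exact case
        push Not at hlg
        have hex : (-1 : ℝ) ^ ArithmeticFunction.cardDistinctFactors m
            = θ * (ArithmeticFunction.liouville m : ℝ) :=
          neg_one_pow_cardDistinctFactors_eval_eq f (L := L) (K := K) hpos hper hnc hP
            (fun p hp hLp => hlg p hp hLp)
        rw [hex, sub_self, abs_zero]
        linarith
    · -- a bad class: `χ = 0`, and some `p ≤ L` has `p^K ∣ f(n)`
      rw [if_neg hP, mul_zero, zero_mul, sub_zero, abs_pow, abs_neg, abs_one, one_pow]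
      push Not at hP
      obtain ⟨p, hp, hpK⟩ := hP
      have hpf : (p : ℤ) ^ K ∣ f.eval (n : ℤ) :=
        (dvd_iff_dvd_of_dvd_sub (pow_dvd_eval_sub_eval f (hper p hp) hnc)).mpr hpK
      have hone : (1 : ℝ) ≤ ∑ p ∈ Nat.primesLE L,
          (if (p : ℤ) ^ K ∣ f.eval (n : ℤ) then (1 : ℝ) else 0) := by
        calc (1 : ℝ) = (if (p : ℤ) ^ K ∣ f.eval (n : ℤ) then (1 : ℝ) else 0) := by rw [if_pos hpf]
          _ ≤ _ := Finset.single_le_sum (f := fun p : ℕ =>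
                (if (p : ℤ) ^ K ∣ f.eval (n : ℤ) then (1 : ℝ) else 0))
              (fun p _ => by split_ifs <;> norm_num) hp
      linarith

end Summit.Parity.BatemanHorn.Theorems.LiouvilleAPToOmega

namespace Summit.Parity.BatemanHorn.Theorems

/-- **Registered sub-goal of this lemma file** (`--supports stmt-Parity-11585`): the parity
identity `(−1)^{ω(m)} = λ(m) · (−1)^{Σ_{p ≤ L prime, p ∣ m} (v_p(m) + 1)}` for `m ≠ 0` free of
squares of primes `> L` — the pointwise heart of the junction `LiouvilleAP → QuadraticOmegaParity`
(binder-free alias of `LiouvilleAPToOmega.neg_one_pow_cardDistinctFactors_eq`). [folklore] -/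
theorem liouvilleAPToOmega_parityIdentity :
    ∀ m L : ℕ, m ≠ 0 → (∀ p : ℕ, p.Prime → L < p → ¬ p ^ 2 ∣ m) →
      (-1 : ℝ) ^ ArithmeticFunction.cardDistinctFactors m =
        (ArithmeticFunction.liouville m : ℝ) *
          (-1 : ℝ) ^ ∑ p ∈ (Nat.primesLE L).filter (fun p : ℕ => p ∣ m), (m.factorization p + 1) :=
  fun _ _ hm h => LiouvilleAPToOmega.neg_one_pow_cardDistinctFactors_eq hm h

end Summit.Parity.BatemanHorn.Theorems
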